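import Summits.ResolutionOfSingularities.ResolutionOfSingularities.Theorems.WeightedInvariantIota3SigmaAscent
import HarnessLib

/-!
# `σ` along the generic fibre point `S → S(X) = S[X]_{𝔪S[X]}` — ASCENT ((o39) sequel, part (D-a))

Route `ResolutionOfSingularities/WeightedInvariant`, crux `Theses.WeightedInvariant.HypersurfaceCentreConstruction`
(stmt-ResolutionOfSingularities-19897), P3 rung, IOTA3-DESIGN §2.3 clause (c10σ) (torus factor); res-L1-w43-plan-1 RULING gen 11 #5 (2)
Q2 (2026-08-27T13:06Z): «σ along S → S(X): ASCENT (flags extend) + descent for infinite residue field by specialisation + finite-κ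
reduction».  This file is the ASCENT third, by instantiating `…Iota3SigmaAscent` (p530558): for a local ring `S` the torus
position `S(X) := Localization.AtPrime ((maximalIdeal S).map Polynomial.C)` (the prime `𝔪S[X]`, Mathlib instance
`Ideal.isPrime_map_C_of_isPrime`) is a FLAT `S`-algebra (free ⊚ localisation) with `𝔪·S(X) = 𝔪_{S(X)}`
(`map_maximalIdeal_genericFibre`), so: the two-flag filtration extends (`map_flagContactFiltration_genericFibre`), `ν` is preserved
(`adicOrder_genericFibre`), two-flags and reached weights ascend (`IsTwoFlag.genericFibre`, `FlagReaches.genericFibre`), and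
`iotaSigma S f ≤ iotaSigma S(X) (C f)` under the two `Nat.sSup` side conditions of p530558 (res-type-073's CAVEAT: an unbounded
ratio set reads `0`).  Elements are spelled `algebraMap S[X] S(X) (C f)` as in (c10) `IotaTorusFactorMonotone`.
DESCENT (parts (D-b)/(D-c)) is NOT in this file.

Def-free helper (`--supports stmt-ResolutionOfSingularities-19897`); OURS bookkeeping on candidate letters; no claim about resolution in
positive characteristic.  AI-written; weaker than expert review.  [OURS · L1 W4.3 · (o39) sequel]
[cite: Matsumura1987, Thm. 7.5 and §8]
-/

noncomputable section

set_option linter.dupNamespace false -- mandated namespace of this single-conjunct summit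

open IsLocalRing Polynomial Literature.AlgebraicGeometry.Resolution
open Summit.ResolutionOfSingularities.ResolutionOfSingularities.Theorems

namespace Summit.ResolutionOfSingularities.ResolutionOfSingularities.Cruxes.HypersurfaceCentreConstruction.LocalEngine

namespace Iota3

section GenericFibre

variable {S : Type} [CommRing S] [IsLocalRing S]

/-- `S(X) = S[X]_{𝔪S[X]}` is a FLAT `S`-algebra (`S[X]` is free, localisation is flat). [folklore] -/
theorem flat_genericFibre :
    Module.Flat S (Localization.AtPrime ((maximalIdeal S).map (C : S →+* S[X]))) :=
  Module.Flat.trans S S[X] _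

/-- The structure map `S → S(X)` is `C` followed by the localisation map. [folklore] -/
theorem algebraMap_genericFibre_apply (f : S) :
    algebraMap S (Localization.AtPrime ((maximalIdeal S).map (C : S →+* S[X]))) f =
      algebraMap S[X] (Localization.AtPrime ((maximalIdeal S).map (C : S →+* S[X]))) (C f) := by
  rw [IsScalarTower.algebraMap_apply S S[X], Polynomial.algebraMap_eq]

/-- **`𝔪·S(X) = 𝔪_{S(X)}`** — the closed fibre of `S → S(X)` is the field `κ(X)`. [folklore] -/
theorem map_maximalIdeal_genericFibre :
    (maximalIdeal S).map (algebraMap S (Localization.AtPrime ((maximalIdeal S).map (C : S →+* S[X])))) =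
      maximalIdeal (Localization.AtPrime ((maximalIdeal S).map (C : S →+* S[X]))) := by
  rw [IsScalarTower.algebraMap_eq S S[X] (Localization.AtPrime ((maximalIdeal S).map (C : S →+* S[X]))),
    ← Ideal.map_map, Polynomial.algebraMap_eq, Localization.AtPrime.map_eq_maximalIdeal]

/-- The two-flag filtration EXTENDS along `S → S(X)`. [folklore] -/
theorem map_flagContactFiltration_genericFibre (g₁ g₂ : S) (q r₁ r₂ n : ℕ) :
    (flagContactFiltration g₁ g₂ q r₁ r₂ n).map (algebraMap S (Localization.AtPrime ((maximalIdeal S).map (C : S →+* S[X])))) =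
      flagContactFiltration (algebraMap S[X] (Localization.AtPrime ((maximalIdeal S).map (C : S →+* S[X]))) (C g₁))
        (algebraMap S[X] (Localization.AtPrime ((maximalIdeal S).map (C : S →+* S[X]))) (C g₂)) q r₁ r₂ n := by
  rw [map_flagContactFiltration_eq _ map_maximalIdeal_genericFibre, algebraMap_genericFibre_apply, algebraMap_genericFibre_apply]

/-- `ν` is preserved along `S → S(X)`. [folklore] -/
theorem adicOrder_genericFibre (f : S) :
    adicOrder (algebraMap S[X] (Localization.AtPrime ((maximalIdeal S).map (C : S →+* S[X]))) (C f)) = adicOrder f := by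
  haveI := flat_genericFibre (S := S)
  rw [← algebraMap_genericFibre_apply, adicOrder_algebraMap_eq_of_flat map_maximalIdeal_genericFibre]

/-- Two-flags ASCEND along `S → S(X)`. [folklore] -/
theorem IsTwoFlag.genericFibre {g₁ g₂ : S} (h : IsTwoFlag g₁ g₂) :
    IsTwoFlag (algebraMap S[X] (Localization.AtPrime ((maximalIdeal S).map (C : S →+* S[X]))) (C g₁))
      (algebraMap S[X] (Localization.AtPrime ((maximalIdeal S).map (C : S →+* S[X]))) (C g₂)) := by
  haveI := flat_genericFibre (S := S)
  rw [← algebraMap_genericFibre_apply, ← algebraMap_genericFibre_apply]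
  exact h.algebraMap_of_flat map_maximalIdeal_genericFibre

/-- Reached weights ASCEND along `S → S(X)`. [folklore] -/
theorem FlagReaches.genericFibre {f : S} {ν q r₁ r₂ : ℕ} (h : FlagReaches f ν q r₁ r₂) :
    FlagReaches (algebraMap S[X] (Localization.AtPrime ((maximalIdeal S).map (C : S →+* S[X]))) (C f)) ν q r₁ r₂ := by
  haveI := flat_genericFibre (S := S)
  rw [← algebraMap_genericFibre_apply]
  exact h.algebraMap_of_flat map_maximalIdeal_genericFibre

/-- **`σ` DOES NOT DECREASE along `S → S(X)`** (the ascent half of (c10σ)), with the two `Nat.sSup` side conditions of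
`iotaSigma_le_of_flat` (upstairs ratio witnesses bounded; at a ratio tie an upstairs bounded non-empty level set forces a
non-empty downstairs one — both automatic under descent). [folklore] -/
theorem iotaSigma_le_genericFibre (f : S)
    (hbdd : BddAbove {m : ℕ | ∃ q r₁ r₂ : ℕ, AdmissibleTriple q r₁ r₂ ∧
        FlagReaches (algebraMap S[X] (Localization.AtPrime ((maximalIdeal S).map (C : S →+* S[X]))) (C f))
          (adicOrder (algebraMap S[X] (Localization.AtPrime ((maximalIdeal S).map (C : S →+* S[X]))) (C f))).toNat q r₁ r₂ ∧
        m * r₂ ≤ ratioScale (adicOrder (algebraMap S[X] (Localization.AtPrime ((maximalIdeal S).map (C : S →+* S[X])))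
          (C f))).toNat * r₁})
    (hcorner : sigmaRatioNat (algebraMap S[X] (Localization.AtPrime ((maximalIdeal S).map (C : S →+* S[X]))) (C f)) =
        sigmaRatioNat f →
      BddAbove (levelSet (algebraMap S[X] (Localization.AtPrime ((maximalIdeal S).map (C : S →+* S[X]))) (C f))) ∧
        (levelSet (algebraMap S[X] (Localization.AtPrime ((maximalIdeal S).map (C : S →+* S[X]))) (C f))).Nonempty →
      (levelSet f).Nonempty) :
    iotaSigma S f ≤ iotaSigma (Localization.AtPrime ((maximalIdeal S).map (C : S →+* S[X])))
      (algebraMap S[X] (Localization.AtPrime ((maximalIdeal S).map (C : S →+* S[X]))) (C f)) := by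
  haveI := flat_genericFibre (S := S)
  rw [← algebraMap_genericFibre_apply] at hbdd hcorner ⊢
  exact iotaSigma_le_of_flat map_maximalIdeal_genericFibre f hbdd hcorner

end GenericFibre

end Iota3

end Summit.ResolutionOfSingularities.ResolutionOfSingularities.Cruxes.HypersurfaceCentreConstruction.LocalEngine

end
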